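import Summits.QuantumFields.BalabanUV.Beta.GAN24.FibreRateLegsD3
import Summits.QuantumFields.BalabanUV.Beta.GAN24.FibreRateMM

/-!
# `BalabanUV.Beta.GAN24.FibreRateLegsM` — binder row G-an2-4 / (CONV-C), road P1-fibre at RELATIVE BLOCKING `Lc^m` («KFIB-RATIO*», part B):
# the four legs (mm, mf, fm, ff) of the (j, m)-resolvent family's closed-form fibre function at `d = 3` in the LITERAL units `(sfStep Lc j, smStep 3 Lc j)`,
# as functions of the alias-sum data — the `m`-analogues of `FibreRateMM.mm_rate`, `FibreRateMF.mf_rate_of_source_data`, `FibreRateLegsD3.fm_rate_of_reading_data`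
# and `FibreRateLegsD3.ff_rate_of_data`

NOT IN PRINT; OUR PROOF ATTEMPT.  HONEST FRAMING (cell contract, verbatim): «discharging `BetaPertH` makes Bałaban's UV stability UNCONDITIONAL — a real
constructive-QFT result; it is NOT the continuum limit and NOT the Clay problem.»  HONEST DEPENDENCY (verbatim): «continuum YM on T⁴ ⇐ BetaPertH ∧ nine spine
estimates (0/9 proved); BetaPertH ⇐ (D1) ∧ (D4) ∧ CAP+tail; G-an2-4 gates asym, D1 and NE2/3/4.»

WHY.  Road FP (binder D1) needs the `j`-geometric real-zone rate of the (j, m)-family `kFibW (Lc^(j+m)) (Lc^j) (sfStep Lc j) (smStep 3 Lc j)` for EVERY `m ≥ 1`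
(gan24-p3-g13's shape `PerfectResolventFibre.RealRateKM 3 Lc m c (Lc⁻²)` = X1m-K; LOCATED remainder CLAIMS l.11347).  The generic two-level engines of road P1's
Part B compare ANY two levels `1 ≤ N ≤ N′` with free decimations `M, M′` (`CapacitanceRateScaled.scaled_cap_inv_inl_inl_rate`, `FibreRateMF.norm_scaled_phiSol_sub_le`,
`FibreRateFeed.norm_scaled_fm_sub_le`, `FibreRateFeedFF.norm_scaled_feed_sub_le`); only the UNIT BOOKKEEPING of the tree's leg lemmas is hard-wired to `N = Lc^(j+1)`.
Here `N = Lc^(j+m)`, `M = Lc^j`, `N′ = Lc^(j+1+m)`, `M′ = Lc^(j+1)`: `sfStep Lc j = N∕Lc^m`, `smStep 3 Lc j = N⁴∕Lc^(4m)`, so the unit-scaled legs are the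
`N`-scaled generic objects times `Lc^(−5m)` (mf∕fm), `Lc^(−8m)` (mm), `Lc^(−2m)` (ff), and a generic two-level rate `K∕N²` becomes `K∕Lc^((k+2)m)·(Lc⁻²)^j`.

## What is proved (`d = 3`, every `Lc ≥ 1`, every `m j`, real `q ∈ [−π, π]^4 ∖ {0}`; [folklore] bookkeeping over the named generic engines)
* §1 `unit_rate_eq` (the exponent bookkeeping), `smStep_three_sq_M`, `sm_sq_mul_phiSol_eq_M`, **`mm_rate_M`** (`≤ crPP 4·|q|⁴∕Lc^(10m)·(Lc⁻²)^j`);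
* §2 `smStep_mul_sfStep_three_M`, `smsf_mul_phiSol_eq_M`, **`mf_rate_of_source_data_M`** (`≤ K_mf∕Lc^(7m)·(Lc⁻²)^j`);
* §3 `sfsm_mul_eq_M`, **`fm_rate_of_reading_data_M`** (`≤ K_fm∕Lc^(7m)·(Lc⁻²)^j`), `sf_sq_mul_ff_eq_M` (the ff readout split `Lc^(−2m)·(tSum + N⁻³N⁵·feed)`),
  **`ff_rate_of_data_M`** (`≤ (T + K_feed)∕Lc^(4m)·(Lc⁻²)^j`, the T-sum two-level rate `‖tSum (Lc^(j+1+m)) (Lc^(j+1)) − tSum (Lc^(j+m)) (Lc^j)‖ ≤ T∕N²` an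
  ORDINARY HYPOTHESIS `hT` — supplied at relative blocking `Lc^m` by leaf-11-g22's «TBLOCK-RATIO*» module, CLAIMS l.11479).
0 def, 0 cited fact, 0 `def … : Prop`, 0 sorry; units `CombesThomas.sfStep∕smStep` BY NAME (TRIGGER-P1 c1∕c2), constants symbolic (c3).
HONEST: NOT summit progress; leg lemmas AS FUNCTIONS of the alias data; discharges NOTHING of (CONV-C); NOT «X1m closed», NEVER «G-an2-4 closed»; NOT BetaPertH,
NOT continuum, NOT Clay.

Unit `b2b-balaban-gan24-formalise-leaf-06` (G-an2-4 formalisation swarm, leaf prover 06), gen 11, 2026-08-20; INTENT «KFIB-RATIO*» CLAIMS l.11491.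
-/

noncomputable section

open Complex Finset
open scoped BigOperators Real

namespace Summit.QuantumFields.BalabanUV.Beta.GAN24.FibreRateLegsM

open Literature.Probability.LatticeModels (TorusSite)
open Literature.MathematicalPhysics.QuantumFieldTheory.Balaban1983to89.B4Strip (ofRealVec)
open Literature.MathematicalPhysics.QuantumFieldTheory.King1986 (momSq momSq_nonneg)
open AliasObjects (cap phiSol cSol srcPhi srcC readW Ahat fhatF eVec)
open FibreRateFeedTerms (rPhiTerm rCTerm)
open FibreRateTBlockSum (tSum)
open CombesThomas (sfStep smStep)
open CapacitanceEndpointBlocks (cPP cPc ccc)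
open CapacitanceRateScaled (crPP crPc crcc scaled_cap_inv_inl_inl_rate)
open FibreRateMM (phiSol_zero_eVec)
open FibreRateMF (norm_scaled_phiSol_sub_le)
open FibreRateFeed (sum_readW_Ahat_fhatF norm_scaled_fm_sub_le)
open FibreRateFeedFF (norm_scaled_feed_sub_le)
open FibreRateLegsD3 (sum_tTerm_eq)

variable {Lc : ℕ} [NeZero Lc]

/-! ## §1 The exponent bookkeeping and the mm leg -/

omit [NeZero Lc] in
/-- [folklore] **THE EXPONENT BOOKKEEPING**: `Lc^(−km)·(K∕(Lc^(j+m))²) = K∕Lc^((k+2)m)·(Lc⁻²)^j`. -/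
theorem unit_rate_eq (hLc : (Lc : ℝ) ≠ 0) (k m j : ℕ) (K : ℝ) :
    ((Lc : ℝ) ^ (k * m))⁻¹ * (K / (((Lc ^ (j + m) : ℕ) : ℝ)) ^ 2) = K / (Lc : ℝ) ^ ((k + 2) * m) * (((Lc : ℝ) ^ 2)⁻¹) ^ j := by
  have e1 : (((Lc ^ (j + m) : ℕ) : ℝ)) ^ 2 = (Lc : ℝ) ^ (2 * j) * (Lc : ℝ) ^ (2 * m) := by push_cast; ring
  have e2 : (Lc : ℝ) ^ ((k + 2) * m) = (Lc : ℝ) ^ (k * m) * (Lc : ℝ) ^ (2 * m) := by rw [← pow_add]; ring_nf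
  have e3 : (((Lc : ℝ) ^ 2)⁻¹) ^ j = ((Lc : ℝ) ^ (2 * j))⁻¹ := by rw [inv_pow, ← pow_mul]
  rw [e1, e2, e3]
  field_simp

omit [NeZero Lc] in
/-- [folklore] **THE mm UNITS AT `(j, m)`**: `smStep 3 Lc j² = (Lc^(j+m))^8 ∕ Lc^(8m)` (`Lc^(8j)`; `smStep` BY NAME — TRIGGER-P1 c2). -/
theorem smStep_three_sq_M (hLc : (Lc : ℝ) ≠ 0) (m j : ℕ) :
    smStep 3 Lc j * smStep 3 Lc j = ((Lc : ℝ) ^ (j + m)) ^ (3 + 1 + 4) / (Lc : ℝ) ^ (8 * m) := by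
  unfold CombesThomas.smStep
  rw [eq_div_iff (pow_ne_zero _ hLc), ← pow_add, ← pow_mul, ← pow_add]
  congr 1
  ring

/-- [folklore] The scaled mm response: `sm_j²·phiSol_N(0, e_l)_κ = Lc^(−8m)·(N^8·(cap N p)⁻¹ (inl κ) (inl l))`, `N = Lc^(j+m)` (`FibreRateMM.phiSol_zero_eVec`). -/
theorem sm_sq_mul_phiSol_eq_M (m j : ℕ) (p : Fin (3 + 1) → ℂ) (l κ : Fin (3 + 1)) :
    ((smStep 3 Lc j * smStep 3 Lc j : ℝ) : ℂ) * phiSol (Lc ^ (j + m)) p 0 (eVec l) κ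
      = ((Lc : ℂ) ^ (8 * m))⁻¹ * (((Lc ^ (j + m) : ℕ) : ℂ) ^ (3 + 1 + 4) * (cap (Lc ^ (j + m)) p)⁻¹ (Sum.inl κ) (Sum.inl l)) := by
  have hLc : (Lc : ℝ) ≠ 0 := Nat.cast_ne_zero.2 (NeZero.ne Lc)
  have hLcC : (Lc : ℂ) ^ (8 * m) ≠ 0 := pow_ne_zero _ (Nat.cast_ne_zero.2 (NeZero.ne Lc))
  rw [phiSol_zero_eVec, smStep_three_sq_M hLc m j]
  push_cast
  field_simp

/-- **mm LEG OF THE (j, m)-FAMILY — FROM THE CAPACITANCE HALF** [folklore]: at `d = 3`, for every `Lc ≥ 1`, every `m j`, every `q ∈ [−π, π]^4 ∖ {0}`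
and all multiplier legs `κ, l`:
`‖sm_{j+1}²·phiSol_{Lc^(j+1+m)}(0, e_l)_κ − sm_j²·phiSol_{Lc^(j+m)}(0, e_l)_κ‖ ≤ (crPP 4·|q|⁴∕Lc^(10m))·(Lc⁻²)^j` (`CapacitanceRateScaled.scaled_cap_inv_inl_inl_rate`). -/
theorem mm_rate_M (m j : ℕ) {q : Fin (3 + 1) → ℝ} (hq : ∀ i, |q i| ≤ π) (hq0 : q ≠ 0) (κ l : Fin (3 + 1)) :
    ‖((smStep 3 Lc (j + 1) * smStep 3 Lc (j + 1) : ℝ) : ℂ) * phiSol (Lc ^ (j + 1 + m)) (ofRealVec q) 0 (eVec l) κ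
        - ((smStep 3 Lc j * smStep 3 Lc j : ℝ) : ℂ) * phiSol (Lc ^ (j + m)) (ofRealVec q) 0 (eVec l) κ‖
      ≤ crPP (3 + 1) * momSq q ^ 2 / (Lc : ℝ) ^ ((8 + 2) * m) * (((Lc : ℝ) ^ 2)⁻¹) ^ j := by
  have hLc1 : 1 ≤ Lc := Nat.one_le_iff_ne_zero.2 (NeZero.ne Lc)
  have hLc0 : (0 : ℝ) < Lc := by exact_mod_cast hLc1
  have hN : 1 ≤ Lc ^ (j + m) := Nat.one_le_pow _ _ hLc1
  have hNN' : Lc ^ (j + m) ≤ Lc ^ (j + 1 + m) := Nat.pow_le_pow_right hLc1 (by omega)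
  have h := scaled_cap_inv_inl_inl_rate (D := 3 + 1) hN hNN' hq hq0 κ l
  rw [sm_sq_mul_phiSol_eq_M m (j + 1) (ofRealVec q) l κ, sm_sq_mul_phiSol_eq_M m j (ofRealVec q) l κ, ← mul_sub,
    norm_mul, norm_inv, norm_pow, Complex.norm_natCast, ← unit_rate_eq hLc0.ne' 8 m j]
  exact mul_le_mul_of_nonneg_left h (inv_nonneg.2 (pow_nonneg hLc0.le _))

/-! ## §2 The mf leg -/

omit [NeZero Lc] in
/-- [folklore] **THE mf UNITS AT `(j, m)`**: `smStep 3 Lc j · sfStep Lc j = (Lc^(j+m))^5 ∕ Lc^(5m)` (`Lc^(4j)·Lc^j`; BY NAME — TRIGGER-P1 c2). -/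
theorem smStep_mul_sfStep_three_M (hLc : (Lc : ℝ) ≠ 0) (m j : ℕ) :
    smStep 3 Lc j * sfStep Lc j = ((Lc : ℝ) ^ (j + m)) ^ (3 + 1 + 1) / (Lc : ℝ) ^ (5 * m) := by
  unfold CombesThomas.smStep CombesThomas.sfStep
  rw [eq_div_iff (pow_ne_zero _ hLc), ← pow_add, ← pow_mul, ← pow_add]
  congr 1
  ring

/-- [folklore] The scaled mf response: `sm_j·sf_j·φ = Lc^(−5m)·(N^5·φ)`, `N = Lc^(j+m)`. -/
theorem smsf_mul_phiSol_eq_M (m j : ℕ) (p : Fin (3 + 1) → ℂ) (fhat : TorusSite (3 + 1) (Lc ^ (j + m)) → Fin (3 + 1) → ℂ) (κ : Fin (3 + 1)) :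
    ((smStep 3 Lc j * sfStep Lc j : ℝ) : ℂ) * phiSol (Lc ^ (j + m)) p fhat 0 κ
      = ((Lc : ℂ) ^ (5 * m))⁻¹ * ((((Lc ^ (j + m) : ℕ) : ℂ) ^ (3 + 1 + 1)) * phiSol (Lc ^ (j + m)) p fhat 0 κ) := by
  have hLc : (Lc : ℝ) ≠ 0 := Nat.cast_ne_zero.2 (NeZero.ne Lc)
  have hLcC : (Lc : ℂ) ^ (5 * m) ≠ 0 := pow_ne_zero _ (Nat.cast_ne_zero.2 (NeZero.ne Lc))
  rw [smStep_mul_sfStep_three_M hLc m j]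
  push_cast
  field_simp

/-- **mf LEG OF THE (j, m)-FAMILY AS A FUNCTION OF THE SOURCE-SIDE DATA** [folklore] (`d = 3`, literal units): force families `f̂` at level
`N = Lc^(j+m)` and `f̂′` at `N′ = Lc^(j+1+m)` whose source-side sums obey the bound∕rate shapes `B_φ, B_c`, `R_φ∕N², R_c∕N²` at unit `N⁻³` give
`‖sm_{j+1}sf_{j+1}·φ′_κ − sm_j sf_j·φ_κ‖ ≤ (4(crPP·|q|⁴B_φ + cPP·|q|²R_φ) + crPc·|q|⁴√|q|²B_c + cPc·|q|²√|q|²R_c)∕Lc^(7m) · (Lc⁻²)^j`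
(`FibreRateMF.norm_scaled_phiSol_sub_le` BY NAME). -/
theorem mf_rate_of_source_data_M (m j : ℕ) {q : Fin (3 + 1) → ℝ} (hq : ∀ i, |q i| ≤ π) (hq0 : q ≠ 0)
    {fhat : TorusSite (3 + 1) (Lc ^ (j + m)) → Fin (3 + 1) → ℂ} {fhat' : TorusSite (3 + 1) (Lc ^ (j + 1 + m)) → Fin (3 + 1) → ℂ}
    {Bφ Bc Rφ Rc : ℝ}
    (hBφ : ∀ l', ‖((((Lc ^ (j + 1 + m) : ℕ) : ℂ) ^ 3)⁻¹) * srcPhi (Lc ^ (j + 1 + m)) (ofRealVec q) fhat' 0 l'‖ ≤ Bφ)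
    (hBc : ‖((((Lc ^ (j + 1 + m) : ℕ) : ℂ) ^ 3)⁻¹) * srcC (Lc ^ (j + 1 + m)) (ofRealVec q) fhat'‖ ≤ Bc)
    (hRφ : ∀ l', ‖((((Lc ^ (j + 1 + m) : ℕ) : ℂ) ^ 3)⁻¹) * srcPhi (Lc ^ (j + 1 + m)) (ofRealVec q) fhat' 0 l'
        - ((((Lc ^ (j + m) : ℕ) : ℂ) ^ 3)⁻¹) * srcPhi (Lc ^ (j + m)) (ofRealVec q) fhat 0 l'‖ ≤ Rφ / (((Lc ^ (j + m) : ℕ) : ℝ)) ^ 2)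
    (hRc : ‖((((Lc ^ (j + 1 + m) : ℕ) : ℂ) ^ 3)⁻¹) * srcC (Lc ^ (j + 1 + m)) (ofRealVec q) fhat'
        - ((((Lc ^ (j + m) : ℕ) : ℂ) ^ 3)⁻¹) * srcC (Lc ^ (j + m)) (ofRealVec q) fhat‖ ≤ Rc / (((Lc ^ (j + m) : ℕ) : ℝ)) ^ 2) (κ : Fin (3 + 1)) :
    ‖((smStep 3 Lc (j + 1) * sfStep Lc (j + 1) : ℝ) : ℂ) * phiSol (Lc ^ (j + 1 + m)) (ofRealVec q) fhat' 0 κ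
        - ((smStep 3 Lc j * sfStep Lc j : ℝ) : ℂ) * phiSol (Lc ^ (j + m)) (ofRealVec q) fhat 0 κ‖
      ≤ ((3 + 1 : ℕ) * (crPP (3 + 1) * momSq q ^ 2 * Bφ + cPP (3 + 1) * momSq q * Rφ)
          + crPc (3 + 1) * (momSq q ^ 2 * Real.sqrt (momSq q)) * Bc + cPc (3 + 1) * (momSq q * Real.sqrt (momSq q)) * Rc) / (Lc : ℝ) ^ ((5 + 2) * m)
        * (((Lc : ℝ) ^ 2)⁻¹) ^ j := by
  have hLc1 : 1 ≤ Lc := Nat.one_le_iff_ne_zero.2 (NeZero.ne Lc)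
  have hLc0 : (0 : ℝ) < Lc := by exact_mod_cast hLc1
  have hN : 1 ≤ Lc ^ (j + m) := Nat.one_le_pow _ _ hLc1
  have hNN' : Lc ^ (j + m) ≤ Lc ^ (j + 1 + m) := Nat.pow_le_pow_right hLc1 (by omega)
  have h := norm_scaled_phiSol_sub_le (D := 3 + 1) hN hNN' hq hq0 hBφ hBc hRφ hRc κ
  rw [smsf_mul_phiSol_eq_M m (j + 1) (ofRealVec q) fhat' κ, smsf_mul_phiSol_eq_M m j (ofRealVec q) fhat κ, ← mul_sub,
    norm_mul, norm_inv, norm_pow, Complex.norm_natCast, ← unit_rate_eq hLc0.ne' 5 m j]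
  refine mul_le_mul_of_nonneg_left ?_ (inv_nonneg.2 (pow_nonneg hLc0.le _))
  convert h using 2

/-! ## §3 The fm and ff legs -/

/-- [folklore] The scaled fm readout in the literal units: `sf_j·sm_j·F = Lc^(−5m)·(N^5·F)`, `N = Lc^(j+m)`. -/
theorem sfsm_mul_eq_M (m j : ℕ) (F : ℂ) :
    ((sfStep Lc j * smStep 3 Lc j : ℝ) : ℂ) * F = ((Lc : ℂ) ^ (5 * m))⁻¹ * ((((Lc ^ (j + m) : ℕ) : ℂ) ^ (3 + 1 + 1)) * F) := by
  have hLc : (Lc : ℝ) ≠ 0 := Nat.cast_ne_zero.2 (NeZero.ne Lc)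
  have hLcC : (Lc : ℂ) ^ (5 * m) ≠ 0 := pow_ne_zero _ (Nat.cast_ne_zero.2 (NeZero.ne Lc))
  rw [mul_comm (sfStep Lc j), smStep_mul_sfStep_three_M hLc m j]
  push_cast
  field_simp

/-- **fm LEG OF THE (j, m)-FAMILY AS A FUNCTION OF THE READING-SIDE DATA** [folklore] (`d = 3`, literal units `sfStep·smStep`, rate `(Lc⁻²)^j`):
with reading-side bounds `A_φ, A_c` (level `N = Lc^(j+m)`, decimation `Lc^j`) and rates `Q_φ∕N², Q_c∕N²` (to `N′ = Lc^(j+1+m)`, decimation `Lc^(j+1)`) at the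
leg `(κ, x′)`: `‖sf_{j+1}sm_{j+1}·F_{j+1} − sf_j sm_j·F_j‖ ≤ (4(Q_φ·cPP|q|² + A_φ·crPP|q|⁴) + Q_c·cPc|q|²√|q|² + A_c·crPc|q|⁴√|q|²)∕Lc^(7m) · (Lc⁻²)^j`
(`FibreRateFeed.norm_scaled_fm_sub_le` BY NAME). -/
theorem fm_rate_of_reading_data_M (m j : ℕ) {q : Fin (3 + 1) → ℝ} (hq : ∀ i, |q i| ≤ π) (hq0 : q ≠ 0) (κ l : Fin (3 + 1))
    (x' : Fin (3 + 1) → ℤ) {Aφ Ac Qφ Qc : ℝ}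
    (hAφ : ∀ l', ‖((((Lc ^ (j + m) : ℕ) : ℂ) ^ 3)⁻¹) * ∑ c, rPhiTerm (Lc ^ (j + m)) (Lc ^ j) (ofRealVec q) c κ l' x'‖ ≤ Aφ)
    (hAc : ‖((((Lc ^ (j + m) : ℕ) : ℂ) ^ 3)⁻¹) * ∑ c, rCTerm (Lc ^ (j + m)) (Lc ^ j) (ofRealVec q) c κ x'‖ ≤ Ac)
    (hQφ : ∀ l', ‖((((Lc ^ (j + 1 + m) : ℕ) : ℂ) ^ 3)⁻¹) * ∑ c, rPhiTerm (Lc ^ (j + 1 + m)) (Lc ^ (j + 1)) (ofRealVec q) c κ l' x'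
        - ((((Lc ^ (j + m) : ℕ) : ℂ) ^ 3)⁻¹) * ∑ c, rPhiTerm (Lc ^ (j + m)) (Lc ^ j) (ofRealVec q) c κ l' x'‖ ≤ Qφ / (((Lc ^ (j + m) : ℕ) : ℝ)) ^ 2)
    (hQc : ‖((((Lc ^ (j + 1 + m) : ℕ) : ℂ) ^ 3)⁻¹) * ∑ c, rCTerm (Lc ^ (j + 1 + m)) (Lc ^ (j + 1)) (ofRealVec q) c κ x'
        - ((((Lc ^ (j + m) : ℕ) : ℂ) ^ 3)⁻¹) * ∑ c, rCTerm (Lc ^ (j + m)) (Lc ^ j) (ofRealVec q) c κ x'‖ ≤ Qc / (((Lc ^ (j + m) : ℕ) : ℝ)) ^ 2) :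
    ‖((sfStep Lc (j + 1) * smStep 3 Lc (j + 1) : ℝ) : ℂ) * ∑ c', readW (Lc ^ (j + 1 + m)) (Lc ^ (j + 1)) (ofRealVec q) c' κ x' *
          Ahat (Lc ^ (j + 1 + m)) (ofRealVec q) 0 (eVec l) c' κ
        - ((sfStep Lc j * smStep 3 Lc j : ℝ) : ℂ) * ∑ c, readW (Lc ^ (j + m)) (Lc ^ j) (ofRealVec q) c κ x' *
          Ahat (Lc ^ (j + m)) (ofRealVec q) 0 (eVec l) c κ‖
      ≤ ((3 + 1 : ℕ) * (Qφ * (cPP (3 + 1) * momSq q) + Aφ * (crPP (3 + 1) * momSq q ^ 2))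
          + Qc * (cPc (3 + 1) * (momSq q * Real.sqrt (momSq q))) + Ac * (crPc (3 + 1) * (momSq q ^ 2 * Real.sqrt (momSq q)))) / (Lc : ℝ) ^ ((5 + 2) * m)
        * (((Lc : ℝ) ^ 2)⁻¹) ^ j := by
  have hLc1 : 1 ≤ Lc := Nat.one_le_iff_ne_zero.2 (NeZero.ne Lc)
  have hLc0 : (0 : ℝ) < Lc := by exact_mod_cast hLc1
  have hN : 1 ≤ Lc ^ (j + m) := Nat.one_le_pow _ _ hLc1
  have hNN' : Lc ^ (j + m) ≤ Lc ^ (j + 1 + m) := Nat.pow_le_pow_right hLc1 (by omega)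
  have h := norm_scaled_fm_sub_le (D := 3 + 1) hN hNN' hq hq0 (Lc ^ j) (Lc ^ (j + 1)) κ l x' hAφ hAc hQφ hQc
  rw [sfsm_mul_eq_M m (j + 1), sfsm_mul_eq_M m j, ← mul_sub, norm_mul, norm_inv, norm_pow, Complex.norm_natCast,
    ← unit_rate_eq hLc0.ne' 5 m j]
  refine mul_le_mul_of_nonneg_left ?_ (inv_nonneg.2 (pow_nonneg hLc0.le _))
  convert h using 2

/-- [folklore] **THE ff READOUT OF THE (j, m)-FAMILY IN THE LITERAL UNITS, SPLIT**: `sf_j²·Σ_c readW·Â(f̂, 0) = Lc^(−2m)·(tSum N M + N⁻³·(N⁵·feed))` at `d = 3`,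
`N = Lc^(j+m)`, `M = Lc^j` (`sfStep Lc j² = N²∕Lc^(2m)`; leaf-11's split through `FibreRateFeed.sum_readW_Ahat_fhatF` and `FibreRateLegsD3.sum_tTerm_eq`). -/
theorem sf_sq_mul_ff_eq_M (m j : ℕ) (q : Fin (3 + 1) → ℝ) (κ l : Fin (3 + 1)) (x' y' : Fin (3 + 1) → ℤ) :
    ((sfStep Lc j * sfStep Lc j : ℝ) : ℂ) * ∑ c, readW (Lc ^ (j + m)) (Lc ^ j) (ofRealVec q) c κ x' *
        Ahat (Lc ^ (j + m)) (ofRealVec q) (fhatF (Lc ^ (j + m)) (Lc ^ j) (ofRealVec q) l y') 0 c κ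
      = ((Lc : ℂ) ^ (2 * m))⁻¹ * (tSum (Lc ^ (j + m)) (Lc ^ j) q κ l x' y'
          + ((((Lc ^ (j + m) : ℕ) : ℂ) ^ 3)⁻¹) * ((((Lc ^ (j + m) : ℕ) : ℂ) ^ (3 + 1 + 1)) *
            (∑ l', (∑ c, rPhiTerm (Lc ^ (j + m)) (Lc ^ j) (ofRealVec q) c κ l' x') *
                phiSol (Lc ^ (j + m)) (ofRealVec q) (fhatF (Lc ^ (j + m)) (Lc ^ j) (ofRealVec q) l y') 0 l'
              + (∑ c, rCTerm (Lc ^ (j + m)) (Lc ^ j) (ofRealVec q) c κ x') *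
                cSol (Lc ^ (j + m)) (ofRealVec q) (fhatF (Lc ^ (j + m)) (Lc ^ j) (ofRealVec q) l y') 0))) := by
  have hLcC : (Lc : ℂ) ≠ 0 := Nat.cast_ne_zero.2 (NeZero.ne Lc)
  have hN : (((Lc ^ (j + m) : ℕ) : ℂ)) ≠ 0 := by exact_mod_cast pow_ne_zero _ (NeZero.ne Lc)
  rw [sum_readW_Ahat_fhatF, sum_tTerm_eq]
  have hsf : ((sfStep Lc j * sfStep Lc j : ℝ) : ℂ) = (((Lc ^ (j + m) : ℕ) : ℂ)) ^ 2 / (Lc : ℂ) ^ (2 * m) := by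
    unfold CombesThomas.sfStep
    push_cast
    field_simp
    ring
  rw [hsf]
  field_simp
  ring

/-- **ff LEG OF THE (j, m)-FAMILY AS A FUNCTION OF THE ALIAS-SUM DATA** [folklore] (`d = 3`, literal unit `sfStep²`, rate `(Lc⁻²)^j`): with the T-sum
two-level rate `‖tSum_{N′,M′} − tSum_{N,M}‖ ≤ T∕N²` (an ORDINARY HYPOTHESIS — leaf-11-g22's «TBLOCK-RATIO*» at relative blocking `Lc^m`), reading-side data
`(A_φ, A_c; Q_φ, Q_c)` at `(κ, x′)` and source-side data `(B_φ, B_c; R_φ, R_c)` for the force `(l, y′)` (leaf-07's PART S at ratio `Lc^m`),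
`‖sf_{j+1}²·FF_{j+1} − sf_j²·FF_j‖ ≤ (T + K_feed)∕Lc^(4m) · (Lc⁻²)^j` (`K_feed` as in `FibreRateFeedFF.norm_scaled_feed_sub_le`, `N = Lc^(j+m)`). -/
theorem ff_rate_of_data_M (m j : ℕ) {q : Fin (3 + 1) → ℝ} (hq : ∀ i, |q i| ≤ π) (hq0 : q ≠ 0) (κ l : Fin (3 + 1)) (x' y' : Fin (3 + 1) → ℤ)
    {T Aφ Ac Qφ Qc Bφ Bc Rφ Rc : ℝ}
    (hT : ‖tSum (Lc ^ (j + 1 + m)) (Lc ^ (j + 1)) q κ l x' y' - tSum (Lc ^ (j + m)) (Lc ^ j) q κ l x' y'‖ ≤ T / (((Lc ^ (j + m) : ℕ) : ℝ)) ^ 2)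
    (hAφ : ∀ l', ‖((((Lc ^ (j + m) : ℕ) : ℂ) ^ 3)⁻¹) * ∑ c, rPhiTerm (Lc ^ (j + m)) (Lc ^ j) (ofRealVec q) c κ l' x'‖ ≤ Aφ)
    (hAc : ‖((((Lc ^ (j + m) : ℕ) : ℂ) ^ 3)⁻¹) * ∑ c, rCTerm (Lc ^ (j + m)) (Lc ^ j) (ofRealVec q) c κ x'‖ ≤ Ac)
    (hQφ : ∀ l', ‖((((Lc ^ (j + 1 + m) : ℕ) : ℂ) ^ 3)⁻¹) * ∑ c, rPhiTerm (Lc ^ (j + 1 + m)) (Lc ^ (j + 1)) (ofRealVec q) c κ l' x'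
        - ((((Lc ^ (j + m) : ℕ) : ℂ) ^ 3)⁻¹) * ∑ c, rPhiTerm (Lc ^ (j + m)) (Lc ^ j) (ofRealVec q) c κ l' x'‖ ≤ Qφ / (((Lc ^ (j + m) : ℕ) : ℝ)) ^ 2)
    (hQc : ‖((((Lc ^ (j + 1 + m) : ℕ) : ℂ) ^ 3)⁻¹) * ∑ c, rCTerm (Lc ^ (j + 1 + m)) (Lc ^ (j + 1)) (ofRealVec q) c κ x'
        - ((((Lc ^ (j + m) : ℕ) : ℂ) ^ 3)⁻¹) * ∑ c, rCTerm (Lc ^ (j + m)) (Lc ^ j) (ofRealVec q) c κ x'‖ ≤ Qc / (((Lc ^ (j + m) : ℕ) : ℝ)) ^ 2)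
    (hBφ : ∀ l', ‖((((Lc ^ (j + 1 + m) : ℕ) : ℂ) ^ 3)⁻¹) *
        srcPhi (Lc ^ (j + 1 + m)) (ofRealVec q) (fhatF (Lc ^ (j + 1 + m)) (Lc ^ (j + 1)) (ofRealVec q) l y') 0 l'‖ ≤ Bφ)
    (hBc : ‖((((Lc ^ (j + 1 + m) : ℕ) : ℂ) ^ 3)⁻¹) *
        srcC (Lc ^ (j + 1 + m)) (ofRealVec q) (fhatF (Lc ^ (j + 1 + m)) (Lc ^ (j + 1)) (ofRealVec q) l y')‖ ≤ Bc)
    (hRφ : ∀ l', ‖((((Lc ^ (j + 1 + m) : ℕ) : ℂ) ^ 3)⁻¹) *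
          srcPhi (Lc ^ (j + 1 + m)) (ofRealVec q) (fhatF (Lc ^ (j + 1 + m)) (Lc ^ (j + 1)) (ofRealVec q) l y') 0 l'
        - ((((Lc ^ (j + m) : ℕ) : ℂ) ^ 3)⁻¹) * srcPhi (Lc ^ (j + m)) (ofRealVec q) (fhatF (Lc ^ (j + m)) (Lc ^ j) (ofRealVec q) l y') 0 l'‖
        ≤ Rφ / (((Lc ^ (j + m) : ℕ) : ℝ)) ^ 2)
    (hRc : ‖((((Lc ^ (j + 1 + m) : ℕ) : ℂ) ^ 3)⁻¹) *
          srcC (Lc ^ (j + 1 + m)) (ofRealVec q) (fhatF (Lc ^ (j + 1 + m)) (Lc ^ (j + 1)) (ofRealVec q) l y')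
        - ((((Lc ^ (j + m) : ℕ) : ℂ) ^ 3)⁻¹) * srcC (Lc ^ (j + m)) (ofRealVec q) (fhatF (Lc ^ (j + m)) (Lc ^ j) (ofRealVec q) l y')‖
        ≤ Rc / (((Lc ^ (j + m) : ℕ) : ℝ)) ^ 2) :
    ‖((sfStep Lc (j + 1) * sfStep Lc (j + 1) : ℝ) : ℂ) * ∑ c', readW (Lc ^ (j + 1 + m)) (Lc ^ (j + 1)) (ofRealVec q) c' κ x' *
          Ahat (Lc ^ (j + 1 + m)) (ofRealVec q) (fhatF (Lc ^ (j + 1 + m)) (Lc ^ (j + 1)) (ofRealVec q) l y') 0 c' κ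
        - ((sfStep Lc j * sfStep Lc j : ℝ) : ℂ) * ∑ c, readW (Lc ^ (j + m)) (Lc ^ j) (ofRealVec q) c κ x' *
          Ahat (Lc ^ (j + m)) (ofRealVec q) (fhatF (Lc ^ (j + m)) (Lc ^ j) (ofRealVec q) l y') 0 c κ‖
      ≤ (T + ((3 + 1 : ℕ) * (Qφ * ((3 + 1 : ℕ) * (cPP (3 + 1) * momSq q * Bφ) + cPc (3 + 1) * (momSq q * Real.sqrt (momSq q)) * Bc)
              + Aφ * ((3 + 1 : ℕ) * (crPP (3 + 1) * momSq q ^ 2 * Bφ + cPP (3 + 1) * momSq q * Rφ)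
                + crPc (3 + 1) * (momSq q ^ 2 * Real.sqrt (momSq q)) * Bc + cPc (3 + 1) * (momSq q * Real.sqrt (momSq q)) * Rc))
          + Qc * ((3 + 1 : ℕ) * (cPc (3 + 1) * (momSq q * Real.sqrt (momSq q)) * Bφ) + ccc (3 + 1) * momSq q ^ 2 * Bc)
          + Ac * ((3 + 1 : ℕ) * (crPc (3 + 1) * (momSq q ^ 2 * Real.sqrt (momSq q)) * Bφ + cPc (3 + 1) * (momSq q * Real.sqrt (momSq q)) * Rφ)
                + crcc (3 + 1) * momSq q ^ 3 * Bc + ccc (3 + 1) * momSq q ^ 2 * Rc))) / (Lc : ℝ) ^ ((2 + 2) * m)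
        * (((Lc : ℝ) ^ 2)⁻¹) ^ j := by
  have hLc1 : 1 ≤ Lc := Nat.one_le_iff_ne_zero.2 (NeZero.ne Lc)
  have hLc0 : (0 : ℝ) < Lc := by exact_mod_cast hLc1
  have hN : 1 ≤ Lc ^ (j + m) := Nat.one_le_pow _ _ hLc1
  have hNN' : Lc ^ (j + m) ≤ Lc ^ (j + 1 + m) := Nat.pow_le_pow_right hLc1 (by omega)
  have hfeed := norm_scaled_feed_sub_le (D := 3 + 1) hN hNN' hq hq0 (Lc ^ j) (Lc ^ (j + 1)) κ x' hAφ hAc hQφ hQc hBφ hBc hRφ hRc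
  rw [sf_sq_mul_ff_eq_M m (j + 1), sf_sq_mul_ff_eq_M m j, ← mul_sub, norm_mul, norm_inv, norm_pow, Complex.norm_natCast,
    show ∀ (a b c e : ℂ), (a + b) - (c + e) = (a - c) + (b - e) from fun _ _ _ _ => by ring]
  have hsum := (norm_add_le _ _).trans (add_le_add hT hfeed)
  rw [← add_div] at hsum
  rw [← unit_rate_eq hLc0.ne' 2 m j]
  refine mul_le_mul_of_nonneg_left ?_ (inv_nonneg.2 (pow_nonneg hLc0.le _))
  convert hsum using 2

end Summit.QuantumFields.BalabanUV.Beta.GAN24.FibreRateLegsM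

end
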